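import Literature.NumberTheory.EllipticCurves.Kato2004.AdmissibleZetaClass
import Summits.BirchSwinnertonDyer.BirchSwinnertonDyer.Theorems.UniversalToricDescentSigmaEulerMuZero
import Mathlib.Algebra.CharP.Two
import HarnessLib

/-!
# Route ByReductionTypeAtTwo, crux `OrdKatoHalfAtTwoIso` (stmt-BirchSwinnertonDyer-19573), line
# `steinberg-fibre-at-two`, RE-CUT SOCKET 2 (F1μ): the `μ`-invariant of Kato's Λ-adic MULTIPLIER at `p = 2` is `0`
# (MEMO-5′ Δ9 / checkpoint C3 in the kernel) — the witness `s ∉ (2)` of the zeta image clause at `(2)`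

Seat `cruxlead-stmt-BirchSwinnertonDyer-19573-w3` (prover WIDTH under the LEAD `cruxlead-19573`; HOME
`run/shared/lean/pub/bsd-2adic/`; `--supports` stmt-BirchSwinnertonDyer-23760 `OrdKatoFineZetaAtTwoResidue` / its F1μ re-typing).
HONEST FRAMING (cell bsd-2adic): BSD is not proved by any of this; the socket is NOT proved here; KERNEL lemmas only (no
definition, no named fact, no `sorry`); nothing about any curve is asserted.

WHY THIS FILE. The image clause (e) of the re-cut socket `SteinbergFibreAtTwo.HasZetaColemanMuInputsAtTwo` (p678187) asks,
at the prime `(2)` of `Λ = ℤ₂⟦T⟧`, for `s ∉ (2)` with `s·G₁ ∈ col(ℓ₀ Z)`; in its one-class form (p682177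
`hasZetaColemanMuInputsAtTwo_of_localDualPair_generators`) `s` is the Coleman coordinate of ONE integral Kato class divided by
`G₁`, i.e. — by Thm. 16.6 (2) with Lemma 13.10 (1) / (13.9) — Kato's Λ-adic MULTIPLIER
`M̃ = (c²d²n₁ − cd²n₂Ψ_c − c²dn₃Ψ_d + cdn₄Ψ_cΨ_d)·∏_{ℓ∈E}(ℓ²Ψ_ℓ² − a_ℓℓΨ_ℓ + ε_ℓℓ)` of the tree
(`Kato2004.katoMultiplier`, file `Kato2004/AdmissibleZetaClass.lean`; `Ψ_b = (1+T)^{κ(σ_b)}` the Iwasawa character) times a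
`2`-adic unit (period ratio, Abbes–Ullmo). The cell memo MEMO-5′ (Δ9, audit checkpoint C3) CLAIMS `μ(M̃) = 0`, i.e. `M̃ ∉ (2)`,
«for odd `c, d ≠ ±1`». This file PROVES the precise statement: at `p = 2`, with `c, d` odd, the exponents
`x = κ(σ_c)`, `y = κ(σ_d)` satisfying `x ≠ 0`, `y ≠ 0`, `x ≠ y`, `x + y ≠ 0` (i.e. `1, σ_c, σ_d, σ_cσ_d` pairwise distinct
in `Γ`), NOT all four cusp coordinates `n₁ … n₄` even, and every `ℓ ∈ E` odd with `κ(σ_ℓ) ≠ 0` (automatic: an odd prime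
has Frobenius of infinite order in `Γ ≅ ℤ₂`) — NO hypothesis on `a_ℓ`, `ε_ℓ` — one has `2 ∤ M̃` in `Λ`
(`not_C_two_dvd_katoMultiplier`, `katoMultiplier_not_mem_augIdealP_two`, and the `Ψ`-keyed forms). Reduction mod `2`
(`Λ/2Λ = 𝔽₂⟦T⟧`, a domain): `Ψ_b ↦ u_b = 1 + ε_b` with `ε_b ≠ 0` (`SigmaEulerMu.not_C_p_dvd_onePlusTPow_sub_one`, the tree's
Lucas-free lemma `(1+T)^a ≢ 1 (mod p)` for `a ≠ 0`), the four-cusp factor becomes `n̄₁ + n̄₂u + n̄₃v + n̄₄uv`, which vanishes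
only if all `n̄ᵢ = 0` (odd weight: constant coefficient `1`; weight two: `1+u`, `1+v`, `1+uv`, `u+v`, `u(1+v)`, `v(1+u)` are
non-zero by the four exponent conditions; weight four: `(1+u)(1+v) ≠ 0`), and each Euler factor becomes
`w² + āw + ε̄ ∈ {w², w(w+1), (w+1)², w²+w+1}`, never `0`.

References: [Kato2004Asterisque] Thm. 6.6 (1) (p. 163), §13.9 and Lemma 13.10 (1) (pp. 229–230), Thm. 12.6 (p. 222), Thm.
16.6 (2) (p. 271); [Washington1997] §7.2, §13.1 (`Λ/pΛ ≅ 𝔽_p⟦T⟧`); HOME `bsd-2adic-cruxlead19573-MEMO-5PRIME.md` Δ9 / C3; tree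
`Kato2004/AdmissibleZetaClass.lean` (`katoMultiplier`), `Theorems/UniversalToricDescentSigmaEulerMuZero.lean` (§1, any `p`),
`Theorems/ByReductionTypeAtTwoOrdKatoHalfAtTwoIsoZetaColemanMuSelmerSide.lean` (p682177, the one-class image clause).
-/

set_option autoImplicit false
set_option linter.dupNamespace false

noncomputable section

open scoped Classical
open PowerSeries
open Literature.NumberTheory.EllipticCurves Literature.NumberTheory.EllipticCurves.Kato2004
  Literature.NumberTheory.EllipticCurves.IwasawaCharacter
open Summit.BirchSwinnertonDyer.Rank1Residual.X11b.SigmaEulerMu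

namespace Summit.BirchSwinnertonDyer.BirchSwinnertonDyer.Theorems.SteinbergFibreAtTwo

/-! ## §1 Arithmetic in `𝔽₂⟦T⟧ = Λ/2Λ` -/

section CharTwo

/-- `𝔽₂⟦T⟧` has characteristic `2`. [folklore] -/
private theorem charP_two : CharP (PowerSeries (ZMod 2)) 2 :=
  charP_of_injective_algebraMap (algebraMap (ZMod 2) (PowerSeries (ZMod 2))).injective 2

/-- A power series over `𝔽₂` with constant coefficient `1` is non-zero. [folklore] -/
theorem ne_zero_of_constantCoeff_eq_one' {F : PowerSeries (ZMod 2)} (h : PowerSeries.constantCoeff F = 1) :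
    F ≠ 0 := by
  intro hF
  rw [hF, map_zero] at h
  exact zero_ne_one h

/-- In `𝔽₂⟦T⟧`: `1 + u ≠ 0` when `u ≠ 1`. [folklore] -/
theorem one_add_ne_zero_of_ne_one {u : PowerSeries (ZMod 2)} (hu : u ≠ 1) : 1 + u ≠ 0 := by
  haveI := charP_two
  intro h
  exact hu (CharTwo.add_eq_zero.1 h).symm

/-- In `𝔽₂⟦T⟧`: `u + v ≠ 0` when `u ≠ v`. [folklore] -/
theorem add_ne_zero_of_ne {u v : PowerSeries (ZMod 2)} (huv : u ≠ v) : u + v ≠ 0 := by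
  haveI := charP_two
  intro h
  exact huv (CharTwo.add_eq_zero.1 h)

/-- **The four-cusp factor mod `2` does not vanish.** In the domain `𝔽₂⟦T⟧`, for `u, v` with constant coefficient `1`,
`u ≠ 1`, `v ≠ 1`, `u ≠ v`, `u·v ≠ 1` (the images of `Ψ_c, Ψ_d` when `1, σ_c, σ_d, σ_cσ_d` are pairwise distinct in `Γ`)
and integers `n₁ … n₄` NOT all even, `n̄₁ + n̄₂u + n̄₃v + n̄₄uv ≠ 0`. Sixteen parity cases: odd weight — constant
coefficient `1`; weight two — `1+u, 1+v, u+v, 1+uv, u(1+v), v(1+u)`; weight four — `(1+u)(1+v)`.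
[cite: Kato2004Asterisque, Lemma 13.10 (1) (p. 230)] [cite: Washington1997, §7.2] -/
theorem fourCuspFactor_map_ne_zero {u v : PowerSeries (ZMod 2)} (hu0 : PowerSeries.constantCoeff u = 1)
    (hv0 : PowerSeries.constantCoeff v = 1) (hu : u ≠ 1) (hv : v ≠ 1) (huv : u ≠ v) (huv' : u * v ≠ 1)
    {n₁ n₂ n₃ n₄ : ℤ} (hn : ¬ (Even n₁ ∧ Even n₂ ∧ Even n₃ ∧ Even n₄)) :
    (n₁ : PowerSeries (ZMod 2)) + (n₂ : PowerSeries (ZMod 2)) * u + (n₃ : PowerSeries (ZMod 2)) * v +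
      (n₄ : PowerSeries (ZMod 2)) * u * v ≠ 0 := by
  haveI := charP_two
  have hu' : u ≠ 0 := ne_zero_of_constantCoeff_eq_one' hu0
  have hv' : v ≠ 0 := ne_zero_of_constantCoeff_eq_one' hv0
  have h1u : 1 + u ≠ 0 := one_add_ne_zero_of_ne_one hu
  have h1v : 1 + v ≠ 0 := one_add_ne_zero_of_ne_one hv
  have h1uv : 1 + u * v ≠ 0 := one_add_ne_zero_of_ne_one (fun h => huv' h)
  have huv2 : u + v ≠ 0 := add_ne_zero_of_ne huv
  -- the parities
  by_cases h₁ : Even n₁ <;> by_cases h₂ : Even n₂ <;> by_cases h₃ : Even n₃ <;> by_cases h₄ : Even n₄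
  -- all even: excluded
  · exact absurd ⟨h₁, h₂, h₃, h₄⟩ hn
  all_goals
    simp only [CharTwo.intCast_eq_ite, h₁, h₂, h₃, h₄, ↓reduceIte, zero_mul, one_mul, zero_add, add_zero]
  -- the fifteen non-zero patterns, in the order (n₁ n₂ n₃ n₄) = EEEO, EEOE, EEOO, EOEE, EOEO, EOOE, EOOO, OEEE, …, OOOO
  · -- u*v
    exact mul_ne_zero hu' hv'
  · -- v
    exact hv'
  · -- v + u*v = v * (1 + u)… written as v + u * v
    have : v + u * v = (1 + u) * v := by ring
    rw [this]; exact mul_ne_zero h1u hv'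
  · -- u
    exact hu'
  · -- u + u*v = u * (1+v)
    have : u + u * v = u * (1 + v) := by ring
    rw [this]; exact mul_ne_zero hu' h1v
  · -- u + v
    exact huv2
  · -- u + v + u*v : constant coefficient 1
    refine ne_zero_of_constantCoeff_eq_one' ?_
    simp only [map_add, map_mul, hu0, hv0, mul_one]
    decide
  · -- 1
    exact one_ne_zero
  · -- 1 + u*v
    exact h1uv
  · -- 1 + v
    exact h1v
  · -- 1 + v + u*v : constant coefficient 1
    refine ne_zero_of_constantCoeff_eq_one' ?_
    simp only [map_add, map_mul, map_one, hu0, hv0, mul_one]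
    decide
  · -- 1 + u
    exact h1u
  · -- 1 + u + u*v : constant coefficient 1
    refine ne_zero_of_constantCoeff_eq_one' ?_
    simp only [map_add, map_mul, map_one, hu0, hv0, mul_one]
    decide
  · -- 1 + u + v : constant coefficient 1
    refine ne_zero_of_constantCoeff_eq_one' ?_
    simp only [map_add, map_one, hu0, hv0]
    decide
  · -- 1 + u + v + u*v = (1+u)(1+v)
    have : (1 : PowerSeries (ZMod 2)) + u + v + u * v = (1 + u) * (1 + v) := by ring
    rw [this]; exact mul_ne_zero h1u h1v

/-- **An Euler factor mod `2` does not vanish.** In `𝔽₂⟦T⟧`, for `w` with constant coefficient `1` and `w ≠ 1` (the image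
of `Ψ_ℓ`, `σ_ℓ ≠ 1` in `Γ`) and `ā, ε̄ ∈ {0, 1}`: `w² + āw + ε̄ ≠ 0` — the four shapes are `w²`, `w(w+1)`, `(w+1)²`,
`w² + w + 1`. No hypothesis on the Dirichlet coefficient `a_ℓ` or on `ε_ℓ` (good or bad `ℓ`) is needed.
[cite: Kato2004Asterisque, Ex. 13.3 (p. 225), §13.9 (p. 229)] [cite: Washington1997, §7.2] -/
theorem eulerFactor_map_ne_zero {w : PowerSeries (ZMod 2)} (hw0 : PowerSeries.constantCoeff w = 1) (hw : w ≠ 1)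
    {a e : ℤ} : w ^ 2 + (a : PowerSeries (ZMod 2)) * w + (e : PowerSeries (ZMod 2)) ≠ 0 := by
  haveI := charP_two
  have hw' : w ≠ 0 := ne_zero_of_constantCoeff_eq_one' hw0
  have h1w : 1 + w ≠ 0 := one_add_ne_zero_of_ne_one hw
  by_cases ha : Even a <;> by_cases he : Even e
  all_goals
    simp only [CharTwo.intCast_eq_ite, ha, he, ↓reduceIte, zero_mul, one_mul, add_zero]
  · -- w^2
    exact pow_ne_zero 2 hw'
  · -- w^2 + 1 = (1 + w)^2
    have : w ^ 2 + 1 = (1 + w) ^ 2 := by rw [CharTwo.add_sq, one_pow, add_comm]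
    rw [this]; exact pow_ne_zero 2 h1w
  · -- w^2 + w = w (1 + w)
    have : w ^ 2 + w = w * (1 + w) := by ring
    rw [this]; exact mul_ne_zero hw' h1w
  · -- w^2 + w + 1 : constant coefficient 1
    refine ne_zero_of_constantCoeff_eq_one' ?_
    simp only [map_add, map_pow, map_one, hw0, one_pow]
    decide

end CharTwo

/-! ## §2 The images of `(1+T)^x` in `𝔽₂⟦T⟧` -/

section Images

/-- The image of `(1+T)^x` in `𝔽₂⟦T⟧` has constant coefficient `1`. [cite: Washington1997, §7.2] -/
theorem constantCoeff_map_onePlusTPow_two (x : ℤ_[2]) :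
    PowerSeries.constantCoeff
      (PowerSeries.map (PadicInt.toZMod (p := 2)) (onePlusTPow 2 ℤ_[2] x : IwasawaAlgebra 2)) = 1 := by
  rw [← PowerSeries.coeff_zero_eq_constantCoeff_apply, PowerSeries.coeff_map, val_onePlusTPow,
    PowerSeries.coeff_zero_eq_constantCoeff_apply, PowerSeries.binomialSeries_constantCoeff, map_one]

/-- **`(1+T)^x ≢ 1 (mod 2)` for `x ≠ 0`** (the tree's Lucas-free lemma `not_C_p_dvd_onePlusTPow_sub_one` at `p = 2`, read in
`𝔽₂⟦T⟧`). [cite: Washington1997, §7.2 and §13.1] -/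
theorem map_onePlusTPow_two_ne_one {x : ℤ_[2]} (hx : x ≠ 0) :
    PowerSeries.map (PadicInt.toZMod (p := 2)) (onePlusTPow 2 ℤ_[2] x : IwasawaAlgebra 2) ≠ 1 := by
  intro h
  apply not_C_p_dvd_onePlusTPow_sub_one (p := 2) hx
  rw [C_p_dvd_iff_map_toZMod_eq_zero, map_sub, map_one, h, sub_self]

/-- `(1+T)^x ≢ (1+T)^y (mod 2)` for `x ≠ y` (`(1+T)^x = (1+T)^{x−y}·(1+T)^y` and the previous lemma).
[cite: Washington1997, §7.2] -/
theorem map_onePlusTPow_two_ne {x y : ℤ_[2]} (hxy : x ≠ y) :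
    PowerSeries.map (PadicInt.toZMod (p := 2)) (onePlusTPow 2 ℤ_[2] x : IwasawaAlgebra 2) ≠
      PowerSeries.map (PadicInt.toZMod (p := 2)) (onePlusTPow 2 ℤ_[2] y : IwasawaAlgebra 2) := by
  intro h
  have hsplit : (onePlusTPow 2 ℤ_[2] x : IwasawaAlgebra 2) =
      (onePlusTPow 2 ℤ_[2] (x - y) : IwasawaAlgebra 2) * (onePlusTPow 2 ℤ_[2] y : IwasawaAlgebra 2) := by
    rw [← Units.val_mul, ← onePlusTPow_add, sub_add_cancel]
  rw [hsplit, map_mul] at h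
  have hy0 : PowerSeries.map (PadicInt.toZMod (p := 2)) (onePlusTPow 2 ℤ_[2] y : IwasawaAlgebra 2) ≠ 0 :=
    ne_zero_of_constantCoeff_eq_one' (constantCoeff_map_onePlusTPow_two y)
  have h1 : PowerSeries.map (PadicInt.toZMod (p := 2)) (onePlusTPow 2 ℤ_[2] (x - y) : IwasawaAlgebra 2) = 1 :=
    mul_right_cancel₀ hy0 (by rw [h, one_mul])
  exact map_onePlusTPow_two_ne_one (sub_ne_zero.2 hxy) h1

/-- `(1+T)^x·(1+T)^y ≢ 1 (mod 2)` for `x + y ≠ 0`. [cite: Washington1997, §7.2] -/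
theorem map_onePlusTPow_two_mul_ne_one {x y : ℤ_[2]} (hxy : x + y ≠ 0) :
    PowerSeries.map (PadicInt.toZMod (p := 2)) (onePlusTPow 2 ℤ_[2] x : IwasawaAlgebra 2) *
      PowerSeries.map (PadicInt.toZMod (p := 2)) (onePlusTPow 2 ℤ_[2] y : IwasawaAlgebra 2) ≠ 1 := by
  rw [← map_mul, ← Units.val_mul, ← onePlusTPow_add]
  exact map_onePlusTPow_two_ne_one hxy

end Images

/-! ## §3 `2 ∤ M̃`: the `μ`-invariant of Kato's multiplier at `p = 2` vanishes -/

section Multiplier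

/-- **MEMO-5′ Δ9 / C3 in the kernel: `2 ∤ M̃` in `Λ = ℤ₂⟦T⟧`.** For odd `c, d`, exponents `x, y ∈ ℤ₂` (of `σ_c, σ_d` in
`Γ`) with `x ≠ 0`, `y ≠ 0`, `x ≠ y`, `x + y ≠ 0`, cusp coordinates `n₁ … n₄` NOT all even, and a finite set `E` of ODD primes
with exponents `e ℓ ≠ 0` (of `σ_ℓ`), Kato's multiplier
`katoMultiplier 2 c d n₁ n₂ n₃ n₄ (1+T)^x (1+T)^y E a_• ε_• ((1+T)^{e •})` is NOT divisible by `2`: its `μ`-invariant is `0`.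
No hypothesis on `a_ℓ, ε_ℓ`. Reduction mod `2` + §1 (`fourCuspFactor_map_ne_zero`, `eulerFactor_map_ne_zero`) + §2.
[cite: Kato2004Asterisque, Thm. 6.6 (1) (p. 163), §13.9 and Lemma 13.10 (1) (pp. 229–230)] [cite: Washington1997, §13.1] -/
theorem not_C_two_dvd_katoMultiplier {c d : ℤ} (hc : Odd c) (hd : Odd d) {n₁ n₂ n₃ n₄ : ℤ}
    (hn : ¬ (Even n₁ ∧ Even n₂ ∧ Even n₃ ∧ Even n₄)) {x y : ℤ_[2]} (hx : x ≠ 0) (hy : y ≠ 0) (hxy : x ≠ y)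
    (hxy' : x + y ≠ 0) (E : Finset ℕ) (aℓ εℓ : ℕ → ℤ) {e : ℕ → ℤ_[2]}
    (hE : ∀ ℓ ∈ E, Odd ℓ ∧ e ℓ ≠ 0) :
    ¬ (PowerSeries.C ((2 : ℕ) : ℤ_[2]) : IwasawaAlgebra 2) ∣
      katoMultiplier 2 c d n₁ n₂ n₃ n₄ (onePlusTPow 2 ℤ_[2] x : IwasawaAlgebra 2)
        (onePlusTPow 2 ℤ_[2] y : IwasawaAlgebra 2) E aℓ εℓ
        (fun ℓ => (onePlusTPow 2 ℤ_[2] (e ℓ) : IwasawaAlgebra 2)) := by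
  haveI := charP_two
  rw [C_p_dvd_iff_map_toZMod_eq_zero]
  -- odd integers reduce to `1` in `𝔽₂⟦T⟧`
  have hcR : ((c : ℤ) : PowerSeries (ZMod 2)) = 1 := by
    rw [CharTwo.intCast_eq_ite, if_neg (Int.not_even_iff_odd.2 hc)]
  have hdR : ((d : ℤ) : PowerSeries (ZMod 2)) = 1 := by
    rw [CharTwo.intCast_eq_ite, if_neg (Int.not_even_iff_odd.2 hd)]
  have h₁ : ((c ^ 2 * d ^ 2 * n₁ : ℤ) : PowerSeries (ZMod 2)) = n₁ := by
    rw [Int.cast_mul, Int.cast_mul, Int.cast_pow, Int.cast_pow, hcR, hdR, one_pow, one_mul, one_mul]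
  have h₂ : ((c * d ^ 2 * n₂ : ℤ) : PowerSeries (ZMod 2)) = n₂ := by
    rw [Int.cast_mul, Int.cast_mul, Int.cast_pow, hcR, hdR, one_pow, one_mul, one_mul]
  have h₃ : ((c ^ 2 * d * n₃ : ℤ) : PowerSeries (ZMod 2)) = n₃ := by
    rw [Int.cast_mul, Int.cast_mul, Int.cast_pow, hcR, hdR, one_pow, one_mul, one_mul]
  have h₄ : ((c * d * n₄ : ℤ) : PowerSeries (ZMod 2)) = n₄ := by
    rw [Int.cast_mul, Int.cast_mul, hcR, hdR, one_mul, one_mul]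
  unfold katoMultiplier
  rw [map_mul]
  refine mul_ne_zero ?_ ?_
  · -- the four-cusp factor reduces to `n̄₁ + n̄₂u + n̄₃v + n̄₄uv`
    rw [map_add, map_sub, map_sub, map_mul, map_mul, map_mul, map_mul, map_intCast, map_intCast, map_intCast,
      map_intCast, h₁, h₂, h₃, h₄, CharTwo.sub_eq_add, CharTwo.sub_eq_add]
    exact fourCuspFactor_map_ne_zero (constantCoeff_map_onePlusTPow_two x) (constantCoeff_map_onePlusTPow_two y)
      (map_onePlusTPow_two_ne_one hx) (map_onePlusTPow_two_ne_one hy) (map_onePlusTPow_two_ne hxy)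
      (map_onePlusTPow_two_mul_ne_one hxy') hn
  · -- each Euler factor reduces to `w² + āw + ε̄`
    rw [map_prod, Finset.prod_ne_zero_iff]
    intro ℓ hℓ
    obtain ⟨hℓodd, heℓ⟩ := hE ℓ hℓ
    have hℓR : ((ℓ : ℕ) : PowerSeries (ZMod 2)) = 1 := by
      rw [CharTwo.natCast_eq_ite, if_neg (Nat.not_even_iff_odd.2 hℓodd)]
    have hℓ2 : ((ℓ ^ 2 : ℕ) : PowerSeries (ZMod 2)) = 1 := by
      rw [Nat.cast_pow, hℓR, one_pow]
    have hℓa : ((aℓ ℓ * ℓ : ℤ) : PowerSeries (ZMod 2)) = aℓ ℓ := by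
      rw [Int.cast_mul, Int.cast_natCast, hℓR, mul_one]
    have hℓe : ((εℓ ℓ * ℓ : ℤ) : PowerSeries (ZMod 2)) = εℓ ℓ := by
      rw [Int.cast_mul, Int.cast_natCast, hℓR, mul_one]
    rw [map_add, map_sub, map_mul, map_mul, map_pow, map_natCast, map_intCast, map_intCast, hℓ2, hℓa, hℓe, one_mul,
      CharTwo.sub_eq_add]
    exact eulerFactor_map_ne_zero (constantCoeff_map_onePlusTPow_two (e ℓ)) (map_onePlusTPow_two_ne_one heℓ)

/-- **`M̃ ∉ (2)`** — the F1μ currency (`IwasawaAlgebra.augIdealP 2 = (C 2)`): under the hypotheses of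
`not_C_two_dvd_katoMultiplier`, Kato's multiplier is a witness `s ∉ (2)` for the image clause at `(2)`.
[cite: Kato2004Asterisque, Lemma 13.10 (1) (p. 230), Thm. 16.6 (2) (p. 271), §17.13 (p. 280)] -/
theorem katoMultiplier_not_mem_augIdealP_two {c d : ℤ} (hc : Odd c) (hd : Odd d) {n₁ n₂ n₃ n₄ : ℤ}
    (hn : ¬ (Even n₁ ∧ Even n₂ ∧ Even n₃ ∧ Even n₄)) {x y : ℤ_[2]} (hx : x ≠ 0) (hy : y ≠ 0) (hxy : x ≠ y)
    (hxy' : x + y ≠ 0) (E : Finset ℕ) (aℓ εℓ : ℕ → ℤ) {e : ℕ → ℤ_[2]}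
    (hE : ∀ ℓ ∈ E, Odd ℓ ∧ e ℓ ≠ 0) :
    katoMultiplier 2 c d n₁ n₂ n₃ n₄ (onePlusTPow 2 ℤ_[2] x : IwasawaAlgebra 2)
        (onePlusTPow 2 ℤ_[2] y : IwasawaAlgebra 2) E aℓ εℓ
        (fun ℓ => (onePlusTPow 2 ℤ_[2] (e ℓ) : IwasawaAlgebra 2)) ∉ IwasawaAlgebra.augIdealP 2 := by
  rw [IwasawaAlgebra.augIdealP, Ideal.mem_span_singleton]
  exact not_C_two_dvd_katoMultiplier hc hd hn hx hy hxy hxy' E aℓ εℓ hE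

/-- **`Ψ`-keyed form** (the shape of `AdmissibleZetaClassBody`'s position clause: `Ψ_b = IwasawaCharacter.Psi 2 ℤ₂ K σ_b`,
`= (1+T)^{κ σ_b}` by `Psi_apply`): for a `ℤ₂`-extension `K` of `ℚ` and Galois elements `σc, σd, σℓ ℓ` whose images
`κ σ ∈ ℤ₂` satisfy the four exponent conditions and `κ (σℓ ℓ) ≠ 0`, Kato's multiplier keyed by `Ψ` lies outside `(2)`.
[cite: Kato2004Asterisque, Lemma 13.10 (1) (p. 230)] [cite: Castella2018, §2.1–2.2 (pp. 4–5)] -/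
theorem katoMultiplier_psi_not_mem_augIdealP_two (K : ZpExtension ℚ 2) {c d : ℤ} (hc : Odd c) (hd : Odd d)
    {n₁ n₂ n₃ n₄ : ℤ} (hn : ¬ (Even n₁ ∧ Even n₂ ∧ Even n₃ ∧ Even n₄))
    {σc σd : Field.absoluteGaloisGroup ℚ} (hx : (K σc).toAdd ≠ 0) (hy : (K σd).toAdd ≠ 0)
    (hxy : (K σc).toAdd ≠ (K σd).toAdd) (hxy' : (K σc).toAdd + (K σd).toAdd ≠ 0)
    (E : Finset ℕ) (aℓ εℓ : ℕ → ℤ) {σℓ : ℕ → Field.absoluteGaloisGroup ℚ}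
    (hE : ∀ ℓ ∈ E, Odd ℓ ∧ (K (σℓ ℓ)).toAdd ≠ 0) :
    katoMultiplier 2 c d n₁ n₂ n₃ n₄
        ((IwasawaCharacter.Psi 2 ℤ_[2] K σc : (PowerSeries ℤ_[2])ˣ) : IwasawaAlgebra 2)
        ((IwasawaCharacter.Psi 2 ℤ_[2] K σd : (PowerSeries ℤ_[2])ˣ) : IwasawaAlgebra 2) E aℓ εℓ
        (fun ℓ => ((IwasawaCharacter.Psi 2 ℤ_[2] K (σℓ ℓ) : (PowerSeries ℤ_[2])ˣ) : IwasawaAlgebra 2)) ∉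
      IwasawaAlgebra.augIdealP 2 := by
  simp only [IwasawaCharacter.Psi_apply]
  exact katoMultiplier_not_mem_augIdealP_two hc hd hn hx hy hxy hxy' E aℓ εℓ hE

end Multiplier

end Summit.BirchSwinnertonDyer.BirchSwinnertonDyer.Theorems.SteinbergFibreAtTwo

end
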